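import Literature.Probability.RandomPlanarGeometry.BDGS2012
import Mathlib.Analysis.Subadditive
import Mathlib.Analysis.SpecialFunctions.Pow.Continuity
import HarnessLib

/-!
# Self-avoiding walks on `ℤ^d` as vertex functions; `c_{n+m} ≤ cₙ cₘ` and `cₙ^{1/n} → μ`

Topic `Literature/Probability/RandomPlanarGeometry` (next to `BDGS2012.lean`, whose counts
`Literature.SAW.Zd.countAt d n x = cₙ(x)`, `count d n = cₙ` and `connectiveConstant d = μ = infₙ cₙ^{1/n}`
are used; `d = 2` is `Literature.Probability.RandomPlanarGeometry.SAW.count`, `Literature.Probability.RandomPlanarGeometry.SAW.connectiveConstant` by `rfl`). Source: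
N. Madras, G. Slade, *The Self-Avoiding Walk* (Birkhäuser 1993), §1.1–1.2.

## Contents (namespace `Literature.SAW.Zd`)

A combinatorial model in which the counting arguments of Madras–Slade Ch. 1 and Ch. 3
(splitting, translating, reflecting, concatenating walks) are plain manipulations of functions:

* `walkOfFn ω n h` — the Mathlib walk `ω 0 → ⋯ → ω n` of a graph traced by `ω : ℕ → V`
  (`length_walkOfFn`, `getVert_walkOfFn`);
* `sawFun d n x`, `saws d n` — the `n`-step self-avoiding walks from `0` (to `x` / to any site) as
  a `Finset (ℕ → ℤ^d)` of vertex functions frozen after time `n` (images of the Mathlib walk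
  finsets under `Walk.getVert`), with `card_sawFun : #sawFun d n x = cₙ(x)`,
  `card_saws : #saws d n = cₙ` and the membership characterisations `mem_sawFun`, `mem_saws`
  (start at `0`, `n` nearest-neighbour steps, frozen, injective on `[0, n]`);
* adjacency bookkeeping on `ℤ^d`: `zdGraph_adj_iff_sub`, translation / negation invariance,
  `abs_apply_le_of_adj` (an `n`-step walk stays in the box `{-n,…,n}^d`); the reflection
  symmetry `countAt_neg : cₙ(-x) = cₙ(x)` (Madras–Slade §1.1).

PROVED (all `theorem`s, no named facts):
* `count_add_le` — **`c_{n+m} ≤ cₙ cₘ`** (Madras–Slade (1.2.3)); discharges the named fact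
  `BDGS2012_count_submult` (`BDGS2012_count_submult_holds`);
* `one_le_count` (`cₙ ≥ 1`, `d ≥ 1`), `one_le_connectiveConstant`, `connectiveConstant_pos`;
* `tendsto_count_rpow` — **`cₙ^{1/n} → μ`** for `d ≥ 1` (Madras–Slade (1.2.1), (1.2.9);
  Hammersley–Morton 1954), by Fekete's lemma (Madras–Slade Lemma 1.2.2 = Mathlib
  `Subadditive.tendsto_lim`) applied to `log cₙ`; discharges `BDGS2012_tendsto_count_rpow`
  (`BDGS2012_tendsto_count_rpow_holds`, all `d ≥ 1`) and the planar `Literature.Probability.RandomPlanarGeometry.SAW.tendsto_count_rpow`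
  (`Literature.Probability.RandomPlanarGeometry.SAW.tendsto_count_rpow_holds`). (The discharges live here rather than in `BDGS2012.lean` /
  `SelfAvoidingWalk.lean` because this file imports those.)
-/

noncomputable section

open Filter Topology Literature.Probability.LatticeModels Literature.Probability.Percolation SimpleGraph
open scoped BigOperators

namespace Literature.Probability.RandomPlanarGeometry.SAW.Zd

/-! ### Walks of a simple graph from vertex functions -/

section ofFn

variable {V : Type*} {G : SimpleGraph V}

/-- The walk `ω 0 → ω 1 → ⋯ → ω n` of `G` traced by a function `ω : ℕ → V` whose first `n`
steps are edges of `G`. [folklore] -/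
def walkOfFn (ω : ℕ → V) : (n : ℕ) → (∀ i < n, G.Adj (ω i) (ω (i + 1))) → G.Walk (ω 0) (ω n)
  | 0, _ => .nil
  | n + 1, h => .cons (h 0 (Nat.succ_pos n))
      (walkOfFn (fun i => ω (i + 1)) n fun i hi => h (i + 1) (by omega))

/-- `walkOfFn ω n` has length `n`. [folklore] -/
@[simp] theorem length_walkOfFn (ω : ℕ → V) (n : ℕ) (h : ∀ i < n, G.Adj (ω i) (ω (i + 1))) :
    (walkOfFn ω n h).length = n := by
  induction n generalizing ω with
  | zero => rfl
  | succ n ih => simp [walkOfFn, ih]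

/-- The `i`-th vertex of `walkOfFn ω n` is `ω (min i n)`. [folklore] -/
theorem getVert_walkOfFn (ω : ℕ → V) (n : ℕ) (h : ∀ i < n, G.Adj (ω i) (ω (i + 1))) (i : ℕ) :
    (walkOfFn ω n h).getVert i = ω (min i n) := by
  induction n generalizing ω i with
  | zero => simp [walkOfFn]
  | succ n ih =>
    cases i with
    | zero => simp [walkOfFn]
    | succ i => simp [walkOfFn, Walk.getVert_cons_succ, ih, Nat.succ_min_succ]

end ofFn

/-! ### `n`-step self-avoiding walks on `ℤ^d` as functions `ℕ → ℤ^d` -/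

variable {d : ℕ}

open Classical in
/-- The `n`-step self-avoiding walks on `ℤ^d` from `0` to `x`, as functions `ω : ℕ → ℤ^d`
(`ω i` = position after `i` steps, frozen at `x` for `i ≥ n`): the image of the Mathlib walks
counted by `countAt d n x` under `SimpleGraph.Walk.getVert`. [cite: MadrasSlade1993, §1.1] -/
def sawFun (d n : ℕ) (x : Site d) : Finset (ℕ → Site d) :=
  (((zdGraph d).finsetWalkLength n (0 : Site d) x).filter fun p => p.IsPath).image
    fun p => p.getVert

/-- `#sawFun d n x = cₙ(x)`: a walk is determined by its vertex function. [folklore] -/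
theorem card_sawFun (d n : ℕ) (x : Site d) : (sawFun d n x).card = countAt d n x := by
  classical
  rw [sawFun, countAt, Finset.card_image_of_injective]
  intro p q hpq
  exact Walk.ext_getVert (congrFun hpq)

/-- Membership in `sawFun`: `ω` starts at `0`, makes `n` nearest-neighbour steps, is frozen at
`x` from time `n` on, and visits no site twice during `[0, n]`. [cite: MadrasSlade1993, §1.1] -/
theorem mem_sawFun {n : ℕ} {x : Site d} {ω : ℕ → Site d} :
    ω ∈ sawFun d n x ↔ ω 0 = 0 ∧ (∀ i, n ≤ i → ω i = x) ∧
      (∀ i < n, (zdGraph d).Adj (ω i) (ω (i + 1))) ∧ Set.InjOn ω {i | i ≤ n} := by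
  classical
  constructor
  · intro h
    rw [sawFun, Finset.mem_image] at h
    obtain ⟨p, hp, rfl⟩ := h
    rw [Finset.mem_filter, mem_finsetWalkLength_iff] at hp
    obtain ⟨hlen, hpath⟩ := hp
    refine ⟨p.getVert_zero, fun i hi => p.getVert_of_length_le (hlen ▸ hi),
      fun i hi => p.adj_getVert_succ (hlen ▸ hi), ?_⟩
    have := hpath.getVert_injOn
    rwa [hlen] at this
  · rintro ⟨h0, hend, hadj, hinj⟩
    rw [sawFun, Finset.mem_image]
    refine ⟨(walkOfFn ω n hadj).copy h0 (hend n le_rfl), ?_, ?_⟩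
    · rw [Finset.mem_filter, mem_finsetWalkLength_iff]
      refine ⟨by simp, ?_⟩
      rw [← Walk.IsPath.getVert_injOn_iff]
      intro i hi j hj hij
      simp only [Set.mem_setOf_eq, Walk.length_copy, length_walkOfFn] at hi hj
      simp only [Walk.getVert_copy, getVert_walkOfFn, min_eq_left hi, min_eq_left hj] at hij
      exact hinj hi hj hij
    · funext i
      simp only [Walk.getVert_copy, getVert_walkOfFn]
      rcases le_or_gt i n with hi | hi
      · rw [min_eq_left hi]
      · rw [min_eq_right hi.le, hend n le_rfl, hend i hi.le]


/-! ### Adjacency bookkeeping on `ℤ^d` -/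

/-- Adjacent sites of `ℤ^d` differ by a unit coordinate vector. [folklore] -/
theorem zdGraph_adj_iff_sub (x y : Site d) :
    (zdGraph d).Adj x y ↔ ∃ i, y - x = Pi.single i 1 ∨ x - y = Pi.single i 1 := by
  rw [zdGraph_adj_iff]
  refine exists_congr fun i => ?_
  rw [sub_eq_iff_eq_add', sub_eq_iff_eq_add']

/-- Translation invariance of the nearest-neighbour graph. [folklore] -/
theorem zdGraph_adj_add_right (x y v : Site d) :
    (zdGraph d).Adj (x + v) (y + v) ↔ (zdGraph d).Adj x y := by
  simp only [zdGraph_adj_iff_sub, add_sub_add_right_eq_sub]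

/-- Translation invariance of the nearest-neighbour graph. [folklore] -/
theorem zdGraph_adj_sub_right (x y v : Site d) :
    (zdGraph d).Adj (x - v) (y - v) ↔ (zdGraph d).Adj x y := by
  simp only [zdGraph_adj_iff_sub, sub_sub_sub_cancel_right]

/-- Invariance of the nearest-neighbour graph under `x ↦ -x`. [folklore] -/
theorem zdGraph_adj_neg (x y : Site d) :
    (zdGraph d).Adj (-x) (-y) ↔ (zdGraph d).Adj x y := by
  simp only [zdGraph_adj_iff_sub, neg_sub_neg]
  exact exists_congr fun i => or_comm

/-- Adjacent sites differ by at most `1` in every coordinate. [folklore] -/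
theorem abs_sub_le_one_of_adj {x y : Site d} (h : (zdGraph d).Adj x y) (j : Fin d) :
    |y j - x j| ≤ 1 := by
  obtain ⟨i, hi | hi⟩ := (zdGraph_adj_iff_sub x y).1 h
  · have := congrFun hi j
    simp only [Pi.sub_apply] at this
    rw [this]
    by_cases hij : j = i
    · subst hij; simp
    · simp [Pi.single_eq_of_ne hij]
  · have := congrFun hi j
    simp only [Pi.sub_apply] at this
    rw [abs_sub_comm, this]
    by_cases hij : j = i
    · subst hij; simp
    · simp [Pi.single_eq_of_ne hij]

/-- An `n`-step nearest-neighbour walk from `0` stays in the box `{-n,…,n}^d`: after `i` steps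
every coordinate is at most `i` in absolute value. [folklore] -/
theorem abs_apply_le_of_adj {ω : ℕ → Site d} {n : ℕ} (h0 : ω 0 = 0)
    (hadj : ∀ i < n, (zdGraph d).Adj (ω i) (ω (i + 1))) :
    ∀ i ≤ n, ∀ j, |ω i j| ≤ (i : ℤ) := by
  intro i
  induction i with
  | zero => intro _ j; simp [h0]
  | succ i ih =>
    intro hi j
    have h1 := abs_sub_le_one_of_adj (hadj i (by omega)) j
    have h2 := ih (by omega) j
    calc |ω (i + 1) j| = |(ω (i + 1) j - ω i j) + ω i j| := by ring_nf
      _ ≤ |ω (i + 1) j - ω i j| + |ω i j| := abs_add_le _ _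
      _ ≤ (((i + 1 : ℕ)) : ℤ) := by push_cast; linarith

/-! ### All `n`-step self-avoiding walks from the origin -/

open Classical in
/-- The `n`-step self-avoiding walks on `ℤ^d` from `0` (any endpoint), as functions `ℕ → ℤ^d`
frozen from time `n` on. [cite: MadrasSlade1993, §1.1] -/
def saws (d n : ℕ) : Finset (ℕ → Site d) :=
  (box d n).biUnion fun x => sawFun d n x

/-- Membership in `saws`. [cite: MadrasSlade1993, §1.1] -/
theorem mem_saws {n : ℕ} {ω : ℕ → Site d} :
    ω ∈ saws d n ↔ ω 0 = 0 ∧ (∀ i, n ≤ i → ω i = ω n) ∧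
      (∀ i < n, (zdGraph d).Adj (ω i) (ω (i + 1))) ∧ Set.InjOn ω {i | i ≤ n} := by
  classical
  rw [saws, Finset.mem_biUnion]
  constructor
  · rintro ⟨x, -, hx⟩
    obtain ⟨h0, hend, hadj, hinj⟩ := mem_sawFun.1 hx
    exact ⟨h0, fun i hi => by rw [hend i hi, hend n le_rfl], hadj, hinj⟩
  · rintro ⟨h0, hend, hadj, hinj⟩
    refine ⟨ω n, ?_, mem_sawFun.2 ⟨h0, hend, hadj, hinj⟩⟩
    rw [mem_box]
    intro j
    exact abs_le.1 (abs_apply_le_of_adj h0 hadj n le_rfl j)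

/-- `#saws d n = cₙ`. [folklore] -/
theorem card_saws (d n : ℕ) : (saws d n).card = count d n := by
  classical
  rw [saws, Finset.card_biUnion]
  · simp_rw [card_sawFun]
    rfl
  · intro x _ y _ hxy
    refine Finset.disjoint_left.2 fun ω hx hy => hxy ?_
    exact ((mem_sawFun.1 hx).2.1 n le_rfl).symm.trans ((mem_sawFun.1 hy).2.1 n le_rfl)

/-- The walks of `saws d n` ending at `x` are `sawFun d n x`. [folklore] -/
theorem mem_sawFun_iff_mem_saws {n : ℕ} {x : Site d} {ω : ℕ → Site d} :
    ω ∈ sawFun d n x ↔ ω ∈ saws d n ∧ ω n = x := by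
  rw [mem_sawFun, mem_saws]
  constructor
  · rintro ⟨h0, hend, hadj, hinj⟩
    exact ⟨⟨h0, fun i hi => by rw [hend i hi, hend n le_rfl], hadj, hinj⟩, hend n le_rfl⟩
  · rintro ⟨⟨h0, hend, hadj, hinj⟩, rfl⟩
    exact ⟨h0, hend, hadj, hinj⟩

/-! ### Submultiplicativity `c_{n+m} ≤ cₙ cₘ` -/

/-- **`c_{n+m} ≤ cₙ · cₘ`**: an `(n+m)`-step self-avoiding walk splits into its first `n` steps and
(a translate of) its last `m` steps, injectively. [cite: MadrasSlade1993, §1.2, eq. (1.2.3)] -/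
theorem count_add_le (d n m : ℕ) : count d (n + m) ≤ count d n * count d m := by
  rw [← card_saws, ← card_saws, ← card_saws, ← Finset.card_product]
  refine Finset.card_le_card_of_injOn
    (fun ω => (fun i => ω (min i n), fun i => ω (n + min i m) - ω n)) ?_ ?_
  · intro ω hω
    rw [Finset.mem_coe, mem_saws] at hω
    obtain ⟨h0, hend, hadj, hinj⟩ := hω
    rw [Finset.mem_coe, Finset.mem_product]
    refine ⟨mem_saws.2 ⟨by simpa using h0, ?_, ?_, ?_⟩, mem_saws.2 ⟨by simp, ?_, ?_, ?_⟩⟩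
    · intro i hi
      simp [min_eq_right hi]
    · intro i hi
      have h1 : min i n = i := min_eq_left hi.le
      have h2 : min (i + 1) n = i + 1 := min_eq_left (by omega)
      simp only [h1, h2]
      exact hadj i (by omega)
    · intro i hi j hj hij
      simp only [Set.mem_setOf_eq] at hi hj
      simp only [min_eq_left hi, min_eq_left hj] at hij
      exact hinj (by simp only [Set.mem_setOf_eq]; omega)
        (by simp only [Set.mem_setOf_eq]; omega) hij
    · intro i hi
      simp [min_eq_right hi]
    · intro i hi
      have h1 : min i m = i := min_eq_left hi.le
      have h2 : min (i + 1) m = i + 1 := min_eq_left (by omega)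
      simp only [h1, h2]
      rw [zdGraph_adj_sub_right, ← add_assoc]
      exact hadj (n + i) (by omega)
    · intro i hi j hj hij
      simp only [Set.mem_setOf_eq] at hi hj
      simp only [min_eq_left hi, min_eq_left hj, sub_left_inj] at hij
      have := hinj (by simp only [Set.mem_setOf_eq]; omega)
        (by simp only [Set.mem_setOf_eq]; omega) hij
      omega
  · intro ω hω ω' hω' h
    rw [Finset.mem_coe, mem_saws] at hω hω'
    simp only [Prod.mk.injEq] at h
    obtain ⟨h1, h2⟩ := h
    have hn : ω n = ω' n := by simpa using congrFun h1 n
    funext i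
    rcases le_or_gt i n with hi | hi
    · simpa [min_eq_left hi] using congrFun h1 i
    · obtain ⟨k, rfl⟩ : ∃ k, i = n + k := ⟨i - n, by omega⟩
      rcases le_or_gt k m with hk | hk
      · have := congrFun h2 k
        simp only [min_eq_left hk] at this
        rwa [hn, sub_left_inj] at this
      · have := congrFun h2 m
        simp only [min_self] at this
        rw [hn, sub_left_inj] at this
        rw [hω.2.1 (n + k) (by omega), hω'.2.1 (n + k) (by omega), this]

/-- `BDGS2012_count_submult` holds. [cite: BDGS2012, §1.3, eq. (1.10)] -/
theorem BDGS2012_count_submult_holds : BDGS2012_count_submult :=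
  fun d n m => count_add_le d n m


/-! ### `cₙ ≥ 1`, and `cₙ^{1/n} → μ` by Fekete's lemma -/

/-- The straight walk `i ↦ (min i n) e₀`. [folklore] -/
def straightWalk (d : ℕ) [NeZero d] (n : ℕ) : ℕ → Site d :=
  fun i => Pi.single 0 ((min i n : ℕ) : ℤ)

/-- The straight walk is an `n`-step self-avoiding walk. [folklore] -/
theorem straightWalk_mem_saws (d : ℕ) [NeZero d] (n : ℕ) : straightWalk d n ∈ saws d n := by
  refine mem_saws.2 ⟨by simp [straightWalk], fun i hi => by simp [straightWalk, min_eq_right hi],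
    fun i hi => ?_, ?_⟩
  · rw [zdGraph_adj_iff_sub]
    refine ⟨0, Or.inl ?_⟩
    have h1 : min i n = i := min_eq_left hi.le
    have h2 : min (i + 1) n = i + 1 := min_eq_left (by omega)
    simp only [straightWalk, h1, h2]
    rw [← Pi.single_sub]
    congr 1
    push_cast
    ring
  · intro i hi j hj hij
    simp only [Set.mem_setOf_eq] at hi hj
    have := congrFun hij 0
    simp only [straightWalk, Pi.single_eq_same, min_eq_left hi, min_eq_left hj, Nat.cast_inj] at this
    exact this

/-- `cₙ ≥ 1` on `ℤ^d`, `d ≥ 1`. [cite: MadrasSlade1993, §1.2] -/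
theorem one_le_count (d : ℕ) [NeZero d] (n : ℕ) : 1 ≤ count d n := by
  rw [← card_saws]
  exact Finset.card_pos.2 ⟨_, straightWalk_mem_saws d n⟩

/-- **`cₙ^{1/n} → μ`** (Hammersley–Morton 1954; Madras–Slade (1.2.1) with (1.2.9)
`log μ = inf_N N⁻¹ log c_N`): by submultiplicativity `log cₙ` is subadditive, so Fekete's lemma
(Madras–Slade Lemma 1.2.2, Mathlib `Subadditive.tendsto_lim`) gives convergence of `n⁻¹ log cₙ`
to its infimum, and `μ` is *defined* as `infₙ cₙ^{1/n}`.
[cite: MadrasSlade1993, §1.2, eq. (1.2.1) and (1.2.9)] -/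
theorem tendsto_count_rpow (d : ℕ) [NeZero d] :
    Tendsto (fun n : ℕ => (count d n : ℝ) ^ (1 / (n : ℝ))) atTop (𝓝 (connectiveConstant d)) := by
  have hpos : ∀ n, (0 : ℝ) < count d n := fun n => by exact_mod_cast one_le_count d n
  have hu : Subadditive fun n => Real.log (count d n) := by
    intro m n
    rw [← Real.log_mul (hpos m).ne' (hpos n).ne']
    apply Real.log_le_log (hpos _)
    exact_mod_cast count_add_le d m n
  have hbdd : BddBelow (Set.range fun n : ℕ => Real.log (count d n) / n) := by
    refine ⟨0, ?_⟩
    rintro _ ⟨n, rfl⟩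
    exact div_nonneg (Real.log_nonneg (by exact_mod_cast one_le_count d n)) (Nat.cast_nonneg n)
  have hlim := hu.tendsto_lim hbdd
  have key : ∀ n : ℕ, (count d n : ℝ) ^ (1 / (n : ℝ)) = Real.exp (Real.log (count d n) / n) :=
    fun n => by rw [Real.rpow_def_of_pos (hpos n), mul_one_div]
  have hexp : Tendsto (fun n : ℕ => Real.exp (Real.log (count d n) / n)) atTop
      (𝓝 (Real.exp hu.lim)) :=
    (Real.continuous_exp.tendsto _).comp hlim
  have heq : (fun n : ℕ => (count d n : ℝ) ^ (1 / (n : ℝ))) =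
      fun n => Real.exp (Real.log (count d n) / n) := funext key
  rw [heq]
  convert hexp using 2
  apply le_antisymm
  · refine ge_of_tendsto hexp ?_
    filter_upwards [eventually_ge_atTop 1] with n hn
    rw [← key n]
    exact connectiveConstant_le_rpow (d := d) (by omega)
  · refine le_ciInf fun n => ?_
    have h1 := hu.lim_le_div hbdd (Nat.succ_ne_zero n)
    have h2 := Real.exp_le_exp.2 h1
    rw [← key (n + 1)] at h2
    simpa [Nat.cast_succ] using h2

/-- `BDGS2012_tendsto_count_rpow` holds: `cₙ^{1/n} → μ(d)` for every `d ≥ 1`.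
[cite: BDGS2012, §1.3, eq. (1.12)] -/
theorem BDGS2012_tendsto_count_rpow_holds : BDGS2012_tendsto_count_rpow := by
  intro d hd
  haveI : NeZero d := ⟨by omega⟩
  exact tendsto_count_rpow d

/-- The planar case: `Literature.Probability.RandomPlanarGeometry.SAW.tendsto_count_rpow` holds. [cite: LawlerSchrammWerner2004SAW, §3.1] -/
theorem _root_.Literature.Probability.RandomPlanarGeometry.SAW.tendsto_count_rpow_holds : Literature.Probability.RandomPlanarGeometry.SAW.tendsto_count_rpow :=
  tendsto_count_rpow 2

/-- The connective constant of `ℤ^d`, `d ≥ 1`, is at least `1`. [cite: MadrasSlade1993, §1.2] -/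
theorem one_le_connectiveConstant (d : ℕ) [NeZero d] : 1 ≤ connectiveConstant d :=
  le_ciInf fun n => Real.one_le_rpow (by exact_mod_cast one_le_count d (n + 1)) (by positivity)

/-- The connective constant of `ℤ^d`, `d ≥ 1`, is positive. [cite: MadrasSlade1993, §1.2] -/
theorem connectiveConstant_pos (d : ℕ) [NeZero d] : 0 < connectiveConstant d :=
  one_pos.trans_le (one_le_connectiveConstant d)

/-! ### Reflection symmetry `cₙ(-x) = cₙ(x)` -/

/-- Negation maps `sawFun d n x` into `sawFun d n (-x)` (the lattice symmetry `y ↦ -y` fixes the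
origin and preserves nearest-neighbour steps and self-avoidance). [cite: MadrasSlade1993, §1.1] -/
theorem neg_mem_sawFun {n : ℕ} {x : Site d} {ω : ℕ → Site d} (h : ω ∈ sawFun d n x) :
    (fun i => -ω i) ∈ sawFun d n (-x) := by
  obtain ⟨h0, hend, hadj, hinj⟩ := mem_sawFun.1 h
  refine mem_sawFun.2 ⟨by simp [h0], fun i hi => by simp [hend i hi],
    fun i hi => (zdGraph_adj_neg _ _).2 (hadj i hi), fun i hi j hj hij => ?_⟩
  exact hinj hi hj (neg_injective hij)

/-- **`cₙ(-x) = cₙ(x)`**: the number of `n`-step self-avoiding walks from `0` to `x` is invariant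
under `x ↦ -x` (so the two-point function is even, `G_z(-x) = G_z(x)`, and its Fourier transform
is real). [cite: MadrasSlade1993, §1.1] -/
theorem countAt_neg (d n : ℕ) (x : Site d) : countAt d n (-x) = countAt d n x := by
  have key : ∀ y : Site d, countAt d n y ≤ countAt d n (-y) := fun y => by
    rw [← card_sawFun, ← card_sawFun]
    refine Finset.card_le_card_of_injOn (fun ω i => -ω i) (fun ω hω => neg_mem_sawFun hω) ?_
    intro ω₁ _ ω₂ _ h
    funext i
    exact neg_injective (congrFun h i)
  exact le_antisymm (by simpa using key (-x)) (key x)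

end Literature.Probability.RandomPlanarGeometry.SAW.Zd
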